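import Summits.QuantumFields.QCD.Theses.NestedDissectionSea
import Summits.QuantumFields.QCD.Theorems.EarlyCrosserLaw.Negative.CellPositivityDomain
import Mathlib.Analysis.SpecialFunctions.Integrals.PosLogEqCircleAverage

/-!
# Line `accretive-coarse-jensen` of the crux `EarlyCrosserLaw`: the two-circle Jensen excess of the
# one-site cell in closed form (tightness of the stubs `CrossingCharge`, `ExcessRegular`)

Drefute seat `refuter-drefute-stmt-QuantumFields-13995-0` on the crux `EarlyCrosserLaw`
(stmt-QuantumFields-13995), line `accretive-coarse-jensen`
(`Cruxes/EarlyCrosserLaw/Lines/accretive-coarse-jensen.lean`), deterministic stubs 1–2: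
`CrossingCharge` (a crossing within `r` of the centre charges the two-circle Jensen excess `≥ log (R/r)`) and
`ExcessRegular` (`0 ≤ excess ≤ #cell · log (R/r)`, measurable in `U`).

On the one-site Dirichlet cell `s = (2,2,2,2)` the massless cell operator is `4 • 1`
(`wilsonCell_two_eq_smul_one`, landed p74201), so its characteristic polynomial is `(X - 4)^{#cell}`
(`charpoly_wilsonCell_two`) and the two-circle Jensen excess about a real centre `c` with radii `r, R` is, in
closed form (`jensenExcess_wilsonCell_two`, from Mathlib's `circleAverage_log_norm_sub_const_eq_log_radius_add_posLog`),
`#cell · ((log R + log⁺ (|c - 4| / R)) - (log r + log⁺ (|c - 4| / r)))`.  Consequences: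

* `jensenExcess_wilsonCell_two_of_near`: `|c - 4| ≤ r ≤ R` ⇒ excess `= #cell · log (R / r)` — the upper bound
  of `ExcessRegular` is ATTAINED, and the `log (R / r)` of `CrossingCharge` is sharp up to the unavoidable
  multiplicity `#cell = 12`;
* `jensenExcess_wilsonCell_two_of_far` / `crossingCharge_needs_centre`: `R ≤ |c - 4|` ⇒ excess `= 0` although
  the cell IS singular at `μ' = -4` (`wilsonCell_two_det_eq_zero_iff`) — the centre hypothesis `|μ' + c| ≤ r`
  of `CrossingCharge` cannot be dropped (far grid discs see nothing);
* `oneSite_excess_nonneg` / `oneSite_excess_eq_log_two`: every disc of an `(r, 2r)` pair is charged `≥ 0`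
  (`log⁺ (xy) ≤ log⁺ x + log⁺ y`) and the disc containing the root exactly `log 2`;
* the sixteen children of the one-site box have all sides `1`: EMPTY cells, characteristic polynomial `1`,
  vanishing circle averages (`isEmpty_wilsonBox_child_two`, `charpoly_wilsonCell_child_two`,
  `circleAverage_child_two`) — used by the companion file `JensenDilutionWithoutLowerPin`.

Small-model facts [folklore]; standard axioms; no Theses statement is asserted (Negative lane,
`--supports stmt-QuantumFields-13995`).
-/

noncomputable section

open Matrix Complex Filter Polynomial
open Literature.MathematicalPhysics.QuantumLattice Literature.MathematicalPhysics.QuantumFieldTheory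
  Literature.Probability.LatticeModels

namespace Summit.QuantumFields.QCD.Theorems.EarlyCrosserLawNegative

/-! ## § 0  The two-circle Jensen excess of the one-site cell in closed form (tightness of stubs 1–2) -/

section OneSite

variable {N : ℕ} [NeZero N]

/-- The characteristic polynomial of the massless one-site cell operator is `(X - 4) ^ #cell`.
[folklore] -/
theorem charpoly_wilsonCell_two (hN : 2 ≤ N)
    (U : GaugeConfig 4 N (Matrix.specialUnitaryGroup (Fin 3) ℂ)) (x : TorusSite 4 N) :
    (wilsonCell U 0 x (fun _ => 2)).charpoly =
      (X - C (4 : ℂ)) ^ Fintype.card {p // wilsonBox x (fun _ => (2 : ℕ)) p} := by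
  rw [wilsonCell_two_eq_smul_one hN U 0 x]
  have h4 : ((0 + 4 : ℝ) : ℂ) = 4 := by push_cast; ring
  rw [h4, Matrix.smul_one_eq_diagonal, Matrix.charpoly_diagonal, Finset.prod_const,
    Finset.card_univ]

/-- On the one-site cell, `log ‖charpoly (z)‖ = #cell · log ‖z - 4‖` pointwise. [folklore] -/
theorem log_norm_eval_charpoly_wilsonCell_two (hN : 2 ≤ N)
    (U : GaugeConfig 4 N (Matrix.specialUnitaryGroup (Fin 3) ℂ)) (x : TorusSite 4 N) (z : ℂ) :
    Real.log ‖((wilsonCell U 0 x (fun _ => 2)).charpoly).eval z‖ =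
      (Fintype.card {p // wilsonBox x (fun _ => (2 : ℕ)) p} : ℝ) * Real.log ‖z - 4‖ := by
  rw [charpoly_wilsonCell_two hN U x, eval_pow, eval_sub, eval_X, eval_C, norm_pow, Real.log_pow]

/-- **Closed form of the two-circle Jensen excess on the one-site cell.** [folklore] -/
theorem jensenExcess_wilsonCell_two (hN : 2 ≤ N)
    (U : GaugeConfig 4 N (Matrix.specialUnitaryGroup (Fin 3) ℂ)) (x : TorusSite 4 N)
    (c r R : ℝ) (hr : r ≠ 0) (hR : R ≠ 0) :
    Real.circleAverage (fun z : ℂ => Real.log ‖((wilsonCell U 0 x (fun _ => 2)).charpoly).eval z‖)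
        (c : ℂ) R
      - Real.circleAverage
        (fun z : ℂ => Real.log ‖((wilsonCell U 0 x (fun _ => 2)).charpoly).eval z‖) (c : ℂ) r =
      (Fintype.card {p // wilsonBox x (fun _ => (2 : ℕ)) p} : ℝ) *
        ((Real.log R + Real.posLog (R⁻¹ * |c - 4|)) - (Real.log r + Real.posLog (r⁻¹ * |c - 4|))) := by
  have hfun : (fun z : ℂ => Real.log ‖((wilsonCell U 0 x (fun _ => 2)).charpoly).eval z‖) =
      fun z : ℂ => (Fintype.card {p // wilsonBox x (fun _ => (2 : ℕ)) p} : ℝ) • Real.log ‖z - 4‖ := by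
    funext z
    rw [log_norm_eval_charpoly_wilsonCell_two hN U x z, smul_eq_mul]
  have hnorm : ‖(c : ℂ) - 4‖ = |c - 4| := by
    rw [show (c : ℂ) - 4 = ((c - 4 : ℝ) : ℂ) by push_cast; ring, Complex.norm_real, Real.norm_eq_abs]
  rw [hfun, Real.circleAverage_fun_smul, Real.circleAverage_fun_smul,
    circleAverage_log_norm_sub_const_eq_log_radius_add_posLog hR,
    circleAverage_log_norm_sub_const_eq_log_radius_add_posLog hr, hnorm, smul_eq_mul, smul_eq_mul]
  ring

/-- **`ExcessRegular`'s upper bound is attained; `CrossingCharge` is sharp up to multiplicity.**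
If the small disc contains the (only, `12`-fold) root `4`, the excess is EXACTLY `#cell · log (R / r)`.
[folklore] -/
theorem jensenExcess_wilsonCell_two_of_near (hN : 2 ≤ N)
    (U : GaugeConfig 4 N (Matrix.specialUnitaryGroup (Fin 3) ℂ)) (x : TorusSite 4 N)
    (c r R : ℝ) (hr : 0 < r) (hrR : r ≤ R) (hc : |c - 4| ≤ r) :
    Real.circleAverage (fun z : ℂ => Real.log ‖((wilsonCell U 0 x (fun _ => 2)).charpoly).eval z‖)
        (c : ℂ) R
      - Real.circleAverage
        (fun z : ℂ => Real.log ‖((wilsonCell U 0 x (fun _ => 2)).charpoly).eval z‖) (c : ℂ) r =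
      (Fintype.card {p // wilsonBox x (fun _ => (2 : ℕ)) p} : ℝ) * Real.log (R / r) := by
  have hR : 0 < R := lt_of_lt_of_le hr hrR
  rw [jensenExcess_wilsonCell_two hN U x c r R hr.ne' hR.ne']
  have h0 : 0 ≤ |c - 4| := abs_nonneg _
  have h1 : Real.posLog (R⁻¹ * |c - 4|) = 0 := by
    rw [Real.posLog_eq_zero_iff, abs_of_nonneg (by positivity)]
    rw [inv_mul_le_iff₀ hR]
    linarith
  have h2 : Real.posLog (r⁻¹ * |c - 4|) = 0 := by
    rw [Real.posLog_eq_zero_iff, abs_of_nonneg (by positivity)]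
    rw [inv_mul_le_iff₀ hr]
    linarith
  rw [h1, h2, Real.log_div hR.ne' hr.ne']
  ring

/-- **The centre hypothesis `|μ' + c| ≤ r` of `CrossingCharge` cannot be dropped.**  The one-site
cell is singular at `μ' = -4` for every gauge field, yet a disc pair not reaching the root sees
nothing: for `R ≤ |c - 4|` the excess is `0`. [folklore] -/
theorem jensenExcess_wilsonCell_two_of_far (hN : 2 ≤ N)
    (U : GaugeConfig 4 N (Matrix.specialUnitaryGroup (Fin 3) ℂ)) (x : TorusSite 4 N)
    (c r R : ℝ) (hr : 0 < r) (hrR : r ≤ R) (hc : R ≤ |c - 4|) :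
    Real.circleAverage (fun z : ℂ => Real.log ‖((wilsonCell U 0 x (fun _ => 2)).charpoly).eval z‖)
        (c : ℂ) R
      - Real.circleAverage
        (fun z : ℂ => Real.log ‖((wilsonCell U 0 x (fun _ => 2)).charpoly).eval z‖) (c : ℂ) r = 0 := by
  have hR : 0 < R := lt_of_lt_of_le hr hrR
  have hc0 : 0 < |c - 4| := lt_of_lt_of_le hR hc
  rw [jensenExcess_wilsonCell_two hN U x c r R hr.ne' hR.ne']
  have h1 : Real.posLog (R⁻¹ * |c - 4|) = Real.log (R⁻¹ * |c - 4|) := by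
    rw [Real.posLog_eq_log]
    rw [abs_of_nonneg (by positivity), le_inv_mul_iff₀ hR]
    linarith
  have h2 : Real.posLog (r⁻¹ * |c - 4|) = Real.log (r⁻¹ * |c - 4|) := by
    rw [Real.posLog_eq_log]
    rw [abs_of_nonneg (by positivity), le_inv_mul_iff₀ hr]
    linarith
  rw [h1, h2, Real.log_mul (inv_ne_zero hR.ne') hc0.ne', Real.log_mul (inv_ne_zero hr.ne') hc0.ne',
    Real.log_inv, Real.log_inv]
  ring

/-- **The singular one-site cell is invisible to far discs** (packaging of the previous lemma with
the crossing hypothesis of `CrossingCharge` made explicit: `det (wilsonCell U (-4) x 2) = 0` holds,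
`0 < r < R`, and still the excess about any centre `c` with `R ≤ |c - 4|` is `0 < log (R / r)`).
[folklore] -/
theorem crossingCharge_needs_centre (hN : 2 ≤ N)
    (U : GaugeConfig 4 N (Matrix.specialUnitaryGroup (Fin 3) ℂ)) (x : TorusSite 4 N)
    (c r R : ℝ) (hr : 0 < r) (hrR : r < R) (hc : R ≤ |c - 4|) :
    (wilsonCell U (-4) x (fun _ => 2)).det = 0 ∧
    Real.circleAverage (fun z : ℂ => Real.log ‖((wilsonCell U 0 x (fun _ => 2)).charpoly).eval z‖)
        (c : ℂ) R
      - Real.circleAverage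
        (fun z : ℂ => Real.log ‖((wilsonCell U 0 x (fun _ => 2)).charpoly).eval z‖) (c : ℂ) r
      < Real.log (R / r) := by
  refine ⟨(wilsonCell_two_det_eq_zero_iff hN U (-4) x).mpr rfl, ?_⟩
  rw [jensenExcess_wilsonCell_two_of_far hN U x c r R hr hrR.le hc]
  exact Real.log_pos ((one_lt_div hr).mpr hrR)


/-- **Every disc of the `(r, 2r)` pair is charged non-negatively** (closed form; `log⁺(xy) ≤ log⁺ x + log⁺ y`).
[folklore] -/
theorem oneSite_excess_nonneg {r : ℝ} (hr : 0 < r) {d : ℝ} (hd : 0 ≤ d) :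
    0 ≤ (Real.log (2 * r) + Real.posLog ((2 * r)⁻¹ * d)) - (Real.log r + Real.posLog (r⁻¹ * d)) := by
  have h1 : Real.log (2 * r) = Real.log 2 + Real.log r := Real.log_mul two_ne_zero hr.ne'
  have h2 : Real.posLog (r⁻¹ * d) ≤ Real.posLog 2 + Real.posLog ((2 * r)⁻¹ * d) := by
    have : r⁻¹ * d = 2 * ((2 * r)⁻¹ * d) := by field_simp
    rw [this]
    exact Real.posLog_mul
  have h3 : Real.posLog (2 : ℝ) = Real.log 2 := Real.posLog_eq_log (by norm_num)
  have _ := hd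
  linarith

/-- **The disc containing the root is charged exactly `log 2`** (closed form at `|c - 4| ≤ r`). [folklore] -/
theorem oneSite_excess_eq_log_two {r : ℝ} (hr : 0 < r) {d : ℝ} (hd : 0 ≤ d) (hdr : d ≤ r) :
    (Real.log (2 * r) + Real.posLog ((2 * r)⁻¹ * d)) - (Real.log r + Real.posLog (r⁻¹ * d)) = Real.log 2 := by
  have h2r : 0 < 2 * r := by positivity
  have h1 : Real.posLog ((2 * r)⁻¹ * d) = 0 := by
    rw [Real.posLog_eq_zero_iff, abs_of_nonneg (by positivity), inv_mul_le_iff₀ h2r]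
    linarith
  have h2 : Real.posLog (r⁻¹ * d) = 0 := by
    rw [Real.posLog_eq_zero_iff, abs_of_nonneg (by positivity), inv_mul_le_iff₀ hr]
    linarith
  rw [h1, h2, Real.log_mul two_ne_zero hr.ne']
  ring

omit [NeZero N] in
/-- The sixteen children of the one-site box `s = (2,2,2,2)` have all sides `1`: they are EMPTY cells. [folklore] -/
theorem isEmpty_wilsonBox_child_two (ε : Fin 4 → Bool) :
    IsEmpty {p : TorusSite 4 N × Fin 3 × Fin 4 //
      wilsonBox (halfCorner (fun _ => 2) ε) (halfSides (fun _ => (2 : ℕ)) ε) p} := by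
  refine ⟨fun p => ?_⟩
  obtain ⟨h1, h2⟩ := p.2 0
  have h3 : halfSides (fun _ => (2 : ℕ)) ε 0 = 1 := by
    unfold halfSides
    cases ε 0 <;> rfl
  omega

/-- Hence the massless child cell operators of the one-site box have characteristic polynomial `1` … [folklore] -/
theorem charpoly_wilsonCell_child_two (U : GaugeConfig 4 N (Matrix.specialUnitaryGroup (Fin 3) ℂ))
    (ε : Fin 4 → Bool) :
    (wilsonCell U 0 (halfCorner (fun _ => 2) ε) (halfSides (fun _ => (2 : ℕ)) ε)).charpoly = 1 := by
  haveI := isEmpty_wilsonBox_child_two (N := N) ε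
  exact Matrix.charpoly_isEmpty

/-- … and every circle average of `log ‖charpoly‖` of a child vanishes (so the children's Jensen excess is `0`).
[folklore] -/
theorem circleAverage_child_two (U : GaugeConfig 4 N (Matrix.specialUnitaryGroup (Fin 3) ℂ))
    (ε : Fin 4 → Bool) (c : ℂ) (ρ : ℝ) :
    Real.circleAverage (fun z : ℂ => Real.log
      ‖((wilsonCell U 0 (halfCorner (fun _ => 2) ε) (halfSides (fun _ => (2 : ℕ)) ε)).charpoly).eval z‖) c ρ = 0 := by
  simp only [charpoly_wilsonCell_child_two, eval_one, norm_one, Real.log_one]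
  exact Real.circleAverage_const 0 c ρ

end OneSite

end Summit.QuantumFields.QCD.Theorems.EarlyCrosserLawNegative

end
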